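import Mathlib
import Literature.Analysis.SpecialFunctions.DigammaReflection
import HarnessLib

/-!
# The Mellin symbol of the half-line compression of `log|D|`: `(ψ(s) + ψ(1−s))/2`

Helper file (`--supports stmt-RiemannHypothesis-0098`), no definitions.  Seat rh-explicit-weil-5 gen12 (file of record
`HOME/rh-explicit-weil-5/WEIL5-WALL.md` §1(c)–(d); companion of `Theorems/WeilWallCusp.lean`).

Context (documentation only).  Let `L = log|D|` (Fourier symbol `log|ξ|`) and `P₊` the restriction to the half line `x > 0`.
From `|D|^α x₊^p = x^{p−α}·Γ(p+1)sin(π(p+1−α/2))/(Γ(p+1−α)sin(π(p+1−α)))` (differentiate at `α = 0`) one gets, for `−1 < Re p < 0`,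
`(P₊ L P₊ x₊^p)(x) = x^p·[ψ(−p) − (π/2)cot(πp) − log x]` (checked numerically in the file of record), i.e. the dilation-invariant
operator `P₊LP₊ + log x` acts on `x^{−s}` as multiplication by `κ(s) := ψ(s) + (π/2)cot(πs)`.  This file records the algebra that
makes `κ` manifestly self-adjoint: by the digamma reflection formula (tree: `digamma_one_sub_sub_digamma`),
`κ(s) = ψ(1−s) − (π/2)cot(πs) = (ψ(s) + ψ(1−s))/2`, symmetric under `s ↦ 1 − s`, with `κ(1/2) = ψ(1/2) = −γ − 2 log 2`.
Its antiderivative `½ log(Γ(s)/Γ(1−s))` gives the local solutions `U(s) = e^{−λs}[Γ(s)/Γ(1−s)]^{1/2}` of the compressed eigen-equation,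
whence the wall cusp `𝔉` of `WeilWallCusp.lean`.

Standard axioms only; no `sorry`.
-/

set_option linter.dupNamespace false
set_option autoImplicit false

noncomputable section

open Complex
open scoped Real

namespace Summit.RiemannHypothesis.RiemannHypothesis.Theorems.WeilWallCusp

/-- `ψ(s) + (π/2)·cot(πs) = (ψ(s) + ψ(1−s))/2` for `s ∉ ℤ`: the Mellin multiplier of `P₊ log|D| P₊ + log x` is the symmetric
average of digamma. -/
theorem digamma_add_half_pi_cot_eq_half_sum {s : ℂ} (hs : ∀ n : ℤ, s ≠ n) :
    digamma s + (π / 2) * (Complex.cos (π * s) / Complex.sin (π * s)) = (digamma s + digamma (1 - s)) / 2 := by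
  have h := Literature.Analysis.SpecialFunctions.Complex.digamma_one_sub_sub_digamma hs
  have h' : digamma (1 - s) = digamma s + π * Complex.cos (π * s) / Complex.sin (π * s) := by
    rw [← h]; ring
  rw [h']
  ring

/-- The same written from the `1 − s` side: `ψ(1−s) − (π/2)·cot(πs) = (ψ(s) + ψ(1−s))/2` (`s ∉ ℤ`). -/
theorem digamma_one_sub_sub_half_pi_cot_eq_half_sum {s : ℂ} (hs : ∀ n : ℤ, s ≠ n) :
    digamma (1 - s) - (π / 2) * (Complex.cos (π * s) / Complex.sin (π * s)) = (digamma s + digamma (1 - s)) / 2 := by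
  have h := Literature.Analysis.SpecialFunctions.Complex.digamma_one_sub_sub_digamma hs
  have h' : digamma (1 - s) = digamma s + π * Complex.cos (π * s) / Complex.sin (π * s) := by
    rw [← h]; ring
  rw [h']
  ring

/-- The symbol is symmetric under `s ↦ 1 − s` (self-adjointness of the compressed operator on the critical line). -/
theorem half_sum_digamma_symm (s : ℂ) :
    (digamma s + digamma (1 - s)) / 2 = (digamma (1 - s) + digamma (1 - (1 - s))) / 2 := by
  rw [sub_sub_cancel]
  ring

/-- Its value at the centre `s = 1/2`: `(ψ(1/2) + ψ(1/2))/2 = ψ(1/2) = −2 log 2 − γ`. -/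
theorem half_sum_digamma_one_half :
    (digamma (1 / 2) + digamma (1 - 1 / 2)) / 2 = -2 * Complex.log 2 - Real.eulerMascheroniConstant := by
  rw [show (1 : ℂ) - 1 / 2 = 1 / 2 by norm_num, Complex.digamma_one_half]
  ring

end Summit.RiemannHypothesis.RiemannHypothesis.Theorems.WeilWallCusp

end
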